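import Mathlib.NumberTheory.LSeries.ZetaZeros
import Mathlib.NumberTheory.ArithmeticFunction.VonMangoldt
import Mathlib.Analysis.SpecialFunctions.Gamma.Digamma
import Mathlib.Analysis.SpecialFunctions.Trigonometric.Deriv
import Mathlib.Analysis.Convolution
import Mathlib.Analysis.Calculus.ContDiff.Convolution
import Mathlib.Analysis.Calculus.ContDiff.Operations
import Mathlib.NumberTheory.Harmonic.ZetaAsymp
import Literature.NumberTheory.LFunctions.ZetaZeros
import HarnessLib
import HarnessLib.Audit

-- provenance: harness21/H21/H21/Prelude/AntSieve/WeilExplicit.lean @ 2e50299 (interim HEAD d8f2665); M5 mechanical rewrite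
/-!
# The Weil explicit-formula functional (trunk T-ANT, notion `weil_explicit_functional`)

We set up, in ONE fixed normalisation, the Guinand–Weil explicit formula for the Riemann zeta
function and Weil's quadratic functional whose positivity is equivalent to the Riemann
hypothesis (Weil 1952; Bombieri 2000, Theorems 1–2; Yoshida 1992; Iwaniec–Kowalski Thm 5.12).

## Normalisation (outline D-ANT-8: additive variable, symmetric at `1/2`)

Test functions are plain `g : ℝ → ℂ`, with the admissibility predicate
`IsWeilTest g := ContDiff ℝ ∞ g ∧ HasCompactSupport g` (smooth of compact support). The transform
attached to `g` is
`weilMellin g s = ĝ(s) := ∫ g(t) e^{(s - 1/2) t} dt`.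
Writing `φ(x) := x^{-1/2} g(log x)` (a smooth function of compact support in `(0, ∞)`), `ĝ(s)` is
the ordinary Mellin transform `∫₀^∞ φ(x) x^{s-1} dx` of `φ`; this is the dictionary with the
multiplicative normalisations of Bombieri (2000) and Iwaniec–Kowalski (5.44)–(5.45). On the
critical line `ĝ(1/2 + it) = ∫ g(t') e^{itt'} dt'` is the Fourier transform of `g`.

The involution is `weilReflect g = g̃`, `g̃(t) := conj (g (-t))` (so that
`(g̃)^(s) = conj (ĝ(1 - conj s))`, `weilMellin_weilReflect`), and the convolution is Mathlib's
additive convolution `weilConv g h := g ⋆[ContinuousLinearMap.mul ℂ ℂ] h`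
(`MeasureTheory.convolution`), i.e. `(g ⋆ h)(t) = ∫ g(u) h(t - u) du` (`weilConv_apply`); it
corresponds to multiplicative convolution of the `φ`'s and `ĝh = ĝ · ĥ` (`weilMellin_weilConv`).

## The explicit formula and the sign check

With `Λ` the von Mangoldt function, `ψ = Γ'/Γ` the digamma function and `γ` Euler's constant,
define
* `weilPolarTerm g := ĝ(0) + ĝ(1)`;
* `weilPrimeTerm g := ∑ₙ Λ(n) n^{-1/2} (g(log n) + g(-log n))`;
* `weilArchTerm g := (1/2π) ∫ ĝ(1/2 + it) Re ψ(1/4 + it/2) dt - g(0) log π`;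
* `weilFunctional g := weilPolarTerm g - weilPrimeTerm g + weilArchTerm g`.

**Check of the signs** (recorded as required by the outline). Let
`I := (1/2πi) ∫_{(2)} (-ζ'/ζ)(s) ĝ(s) ds = ∑ₙ Λ(n) φ(n) = ∑ₙ Λ(n) n^{-1/2} g(log n)` by Mellin
inversion. Shift to `Re s = -1`: `-ζ'/ζ` has residue `+1` at the pole `s = 1` and `-m(ρ)` at a
zero of multiplicity `m(ρ)`, so `I = ĝ(1) - ∑_ρ m(ρ) ĝ(ρ) + (1/2πi)∫_{(-1)} (-ζ'/ζ) ĝ`. By the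
functional equation of `Λ(s) = π^{-s/2} Γ(s/2) ζ(s)`,
`-ζ'/ζ(s) = ζ'/ζ(1-s) - log π + ½(ψ(s/2) + ψ((1-s)/2))`. The `ζ'/ζ(1-s)` piece gives, after
`w = 1 - s` and Mellin inversion for `x ↦ x^{-1} φ(1/x)`, the contribution
`-∑ₙ Λ(n) n^{-1} φ(1/n) = -∑ₙ Λ(n) n^{-1/2} g(-log n)`. The remaining integrand is holomorphic in
`-1 ≤ Re s ≤ 1/2` except for the simple pole of `½ ψ(s/2)` at `s = 0` with residue `-ĝ(0)`;
moving the line to `Re s = 1/2` therefore adds `+ĝ(0)`, and on `s = 1/2 + it` one gets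
`(1/2π) ∫ ĝ(1/2+it) (Re ψ(1/4 + it/2) - log π) dt`, where `(1/2π)∫ ĝ(1/2+it) dt = g(0)` by
Fourier inversion. Altogether
`∑_ρ m(ρ) ĝ(ρ) = ĝ(0) + ĝ(1) - ∑ₙ Λ(n) n^{-1/2}(g(log n) + g(-log n))
  + (1/2π)∫ ĝ(1/2+it) Re ψ(1/4+it/2) dt - g(0) log π = weilFunctional g`,
the sum over zeros being the symmetric limit `|Im ρ| ≤ T → ∞`. This is Iwaniec–Kowalski
Theorem 5.12 / (5.44)–(5.45) specialised to `ζ` (degree 1, `κ = 0`, conductor 1, `r = 1`) and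
transported by `φ(x) = x^{-1/2} g(log x)`.

**Bombieri's form of the archimedean term.** Bombieri (2000, Thm 2; `f = φ`,
`f*(x) = x^{-1} f(1/x)`) writes the archimedean contribution as
`-(log 4π + γ) f(1) - ∫₁^∞ (f(x) + f*(x) - (2/x) f(1)) x dx/(x² - 1)`. Under `x = e^t`,
`f(1) = g(0)`, `f(x) + f*(x) = e^{-t/2}(g(t) + g(-t))`, `(2/x) f(1) = 2 e^{-t} g(0)` and
`x dx/(x²-1) = e^t dt/(2 sinh t)`, giving
`weilArchTermBombieri g := -((log 4π + γ) g(0) + ∫₀^∞ (e^{t/2}(g(t)+g(-t)) - 2 g(0))/(2 sinh t) dt)`.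
Consistency with the digamma form: from Gauss' integral
`ψ(z) = -γ + ∫₀^∞ (e^{-u} - e^{-zu})/(1 - e^{-u}) du` (`u = 2t`) and Fourier inversion,
`(1/2π)∫ ĝ(1/2+iτ) Re ψ(1/4+iτ/2) dτ = -γ g(0) - ∫₀^∞ (e^{-t/2}(g(t)+g(-t)) - 2e^{-2t} g(0))/(1-e^{-2t}) dt`,
and the difference of the two `g(0)`-terms is `2 g(0) ∫₀^∞ e^{-t}/(1+e^{-t}) dt = g(0) log 4`,
so the two forms agree (`weilArchTermBombieri_eq_weilArchTerm`).

## Zero side, quadratic functional, positivity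

* `weilZeroSidePartial g T := ∑ᶠ ρ ∈ weilZeroIndex T, m(ρ) ĝ(ρ)`,
  `weilZeroIndex T = {ζ ρ = 0, 0 ≤ Re ρ ≤ 1, 0 < |Im ρ| ≤ T}`, with
  the hypothesis-free order function `Literature.NumberTheory.LFunctions.riemannZetaZeroOrder` from `ZetaZeros` (no divisor);
  `HasWeilZeroSide g Z` is the symmetric-limit statement `weilZeroSidePartial g T → Z`.
* `weilQuadratic g := weilFunctional (g ⋆ g̃)`; `WeilPositivity`, `WeilPositivityOn a` (test
  functions supported in `[-a, a]`; the junk-free shape used for the rh.S29 wall) and the ground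
  energy `weilGroundEnergy a = ε(a)` (an `sInf`, DEFINITION ONLY; statements use
  `WeilPositivityOn`).
  `WeilPositivity` is registered as an OPEN CONJECTURE (`[status: open]`), not a fact awaiting
  discharge: it is equivalent to RH by Weil's criterion, proved in the tree as
  `weil_criterion_holds : RiemannHypothesis ↔ WeilPositivity` (`WeilCriterionProofs.lean`).

The semilocal quadratic form `QW_λ` of the notion text (Connes' cut-off / semilocal trace formula)
is OUT OF SCOPE for v0.

## Mathlib

Mathlib has all ingredients (`MeasureTheory.convolution`, `Complex.digamma`,
`ArithmeticFunction.vonMangoldt`, `Real.eulerMascheroniConstant`, `riemannZeta`,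
`riemannZetaZeros`, `HasCompactSupport`, `ContDiff`, `tsupport`) but no explicit formula and no Weil
functional (searched `explicit formula`, `Guinand`, `Weil` in `NumberTheory/`).

## References

* A. Weil, *Sur les "formules explicites" de la théorie des nombres premiers* (1952).
* E. Bombieri, *Remarks on Weil's quadratic functional in the theory of prime numbers I*,
  Rend. Mat. Acc. Lincei (2000), Theorems 1–2.
* H. Iwaniec, E. Kowalski, *Analytic Number Theory* (2004), Theorem 5.12, (5.44)–(5.45).
* H. Yoshida, *On Hermitian forms attached to zeta functions* (1992).
-/

noncomputable section

open Complex Filter Set MeasureTheory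
open scoped Real Topology Convolution ContDiff ArithmeticFunction.vonMangoldt ComplexConjugate

namespace Literature.NumberTheory.LFunctions

/-! ## Test functions, transform, involution, convolution -/

/-- Admissible test functions for the Weil functional: smooth (`C^∞`, i.e. `ContDiff ℝ ∞`, not
analytic) complex-valued functions on `ℝ` with compact support (Weil 1952; Bombieri 2000 §2, in
the additive variable `t = log x`). [cite: Weil1952] -/
def IsWeilTest (g : ℝ → ℂ) : Prop :=
  ContDiff ℝ ∞ g ∧ HasCompactSupport g

/-- The Mellin–Laplace transform in the additive normalisation symmetric at `1/2`:
`ĝ(s) = ∫ g(t) e^{(s - 1/2) t} dt`. It is the Mellin transform of `x ↦ x^{-1/2} g(log x)`, and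
`ĝ(1/2 + it)` is the Fourier transform of `g` (Bombieri 2000 Thm 2 with `x = e^t`; outline
D-ANT-8). [cite: Bombieri2000, Thm 2 with  x = e^t] -/
def weilMellin (g : ℝ → ℂ) (s : ℂ) : ℂ :=
  ∫ t : ℝ, g t * cexp ((s - 1 / 2) * t)

/-- The involution `g̃(t) = conj (g(-t))` (Bombieri's `f*` transported to the additive,
`1/2`-symmetric normalisation; Weil 1952). [cite: Weil1952] -/
def weilReflect (g : ℝ → ℂ) : ℝ → ℂ :=
  fun t ↦ conj (g (-t))

/-- Additive convolution `(g ⋆ h)(t) = ∫ g(u) h(t - u) du`; this IS Mathlib's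
`MeasureTheory.convolution` for the bilinear map `ContinuousLinearMap.mul ℂ ℂ` and Lebesgue
measure. It corresponds to multiplicative convolution in `x = e^t` (Bombieri 2000 §2). [cite: Bombieri2000, §2] -/
def weilConv (g h : ℝ → ℂ) : ℝ → ℂ :=
  g ⋆[ContinuousLinearMap.mul ℂ ℂ] h

/-- Unfolding the convolution: `(g ⋆ h)(t) = ∫ g(u) h(t - u) du`
(`MeasureTheory.convolution_def`). [folklore] -/
theorem weilConv_apply (g h : ℝ → ℂ) (t : ℝ) :
    weilConv g h t = ∫ u : ℝ, g u * h (t - u) := by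
  simp [weilConv, convolution_def]

/-- The same convolution for the `ℝ`-bilinear multiplication map `ContinuousLinearMap.mul ℝ ℂ`
(the form to which Mathlib's smoothness lemmas over the real base field apply). [folklore] -/
theorem weilConv_eq_convolution_real (g h : ℝ → ℂ) :
    weilConv g h = g ⋆[ContinuousLinearMap.mul ℝ ℂ] h := by
  ext t
  simp [weilConv, convolution_def]

/-! ## The three sides of the explicit formula -/

/-- The polar term `ĝ(0) + ĝ(1)` (contributions of the pole of `ζ` at `s = 1` and, via the
functional equation, at `s = 0`; IK (5.45), Bombieri 2000 Thm 2). [cite: Bombieri2000, Thm 2] -/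
def weilPolarTerm (g : ℝ → ℂ) : ℂ :=
  weilMellin g 0 + weilMellin g 1

/-- The prime term `∑ₙ Λ(n) n^{-1/2} (g(log n) + g(-log n))` (IK (5.45); Bombieri 2000 Thm 2
with `x = e^t`). For `g` of compact support the sum is finite (`summable_weilPrimeTerm`); the
`n = 0` term vanishes since `Λ 0 = 0`. [cite: Bombieri2000, Thm 2 with  x = e^t] -/
def weilPrimeTerm (g : ℝ → ℂ) : ℂ :=
  ∑' n : ℕ, ((Λ n : ℝ) : ℂ) / (Real.sqrt n : ℂ) * (g (Real.log n) + g (-Real.log n))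

/-- The archimedean integral `∫ ĝ(1/2 + it) Re ψ(1/4 + it/2) dt` of the digamma form of the
explicit formula (Iwaniec–Kowalski Thm 5.12 / (5.44) for `ζ`, gamma factor `π^{-s/2} Γ(s/2)`).
Kept as a separate definition so that no `+`/`-` can be captured by the `∫` binder
(cf. `weilArchTerm_eq`). [folklore] -/
def weilArchIntegral (g : ℝ → ℂ) : ℂ :=
  ∫ t : ℝ, weilMellin g (1 / 2 + t * I) * ((Complex.digamma (1 / 4 + t / 2 * I)).re : ℂ)

/-- The archimedean term in digamma form,
`(1/2π) ∫ ĝ(1/2 + it) Re ψ(1/4 + it/2) dt - g(0) log π`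
(Iwaniec–Kowalski Thm 5.12 / (5.44) for `ζ`: gamma factor `π^{-s/2} Γ(s/2)`). See the module
docstring for the derivation and `weilArchTermBombieri` for Bombieri's form. The term
`- g(0) log π` is OUTSIDE the integral (`weilArchTerm_eq`). [folklore] -/
def weilArchTerm (g : ℝ → ℂ) : ℂ :=
  (1 / (2 * π) : ℂ) * weilArchIntegral g - g 0 * (Real.log π : ℂ)

/-- Sanity check of the parse of `weilArchTerm` (review of attempt 0: the `- g 0 * log π` must not
be swallowed by the integral binder): `W_∞(g) = (1/2π) (∫ …) - g(0) log π`. [folklore] -/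
theorem weilArchTerm_eq (g : ℝ → ℂ) :
    weilArchTerm g =
      (1 / (2 * π) : ℂ) * (∫ t : ℝ, weilMellin g (1 / 2 + t * I) *
          ((Complex.digamma (1 / 4 + t / 2 * I)).re : ℂ)) - g 0 * (Real.log π : ℂ) :=
  rfl

/-- The archimedean term in Bombieri's form (Bombieri 2000 Thm 2, transported by `x = e^t`):
`-((log 4π + γ) g(0) + ∫₀^∞ (e^{t/2}(g(t) + g(-t)) - 2 g(0)) / (2 sinh t) dt)`.
The integrand extends continuously to `t = 0` (with value `g(0)/2`, the odd first-order terms of `g(t) + g(-t)` cancelling) and decays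
like `e^{-t}` for `t` beyond the support of `g`. Equal to `weilArchTerm g`
(`weilArchTermBombieri_eq_weilArchTerm`). [cite: Bombieri2000, Thm 2  transported by  x = e^t] -/
def weilArchTermBombieri (g : ℝ → ℂ) : ℂ :=
  -((Real.log (4 * π) + Real.eulerMascheroniConstant : ℂ) * g 0 +
    (∫ t in Ioi (0 : ℝ), ((Real.exp (t / 2) : ℂ) * (g t + g (-t)) - 2 * g 0) /
      (2 * Real.sinh t : ℂ)))

/-- Sanity check of the parse of `weilArchTermBombieri`: with `B := ∫₀^∞ …` the term is
`-(log 4π + γ) g(0) - B`. [folklore] -/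
theorem weilArchTermBombieri_eq (g : ℝ → ℂ) :
    weilArchTermBombieri g =
      -(Real.log (4 * π) + Real.eulerMascheroniConstant : ℂ) * g 0 -
        ∫ t in Ioi (0 : ℝ), ((Real.exp (t / 2) : ℂ) * (g t + g (-t)) - 2 * g 0) /
          (2 * Real.sinh t : ℂ) := by
  unfold weilArchTermBombieri
  ring

/-- The Weil functional `W(g) := (ĝ(0) + ĝ(1)) - ∑ₙ Λ(n) n^{-1/2}(g(log n) + g(-log n)) + W_∞(g)`,
normalised so that the explicit formula reads `∑_ρ m(ρ) ĝ(ρ) = W(g)` (`explicit_formula`;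
Weil 1952; Bombieri 2000 Thm 2; IK Thm 5.12). The sign check is in the module docstring. [cite: Weil1952] -/
def weilFunctional (g : ℝ → ℂ) : ℂ :=
  weilPolarTerm g - weilPrimeTerm g + weilArchTerm g

/-! ## The zero side -/

/-- The index set of the truncated zero side: zeros of `ζ` with `0 ≤ Re ρ ≤ 1` and
`0 < |Im ρ| ≤ T`. The conditions `Im ρ ≠ 0`, `0 ≤ Re ρ ≤ 1` exclude the pole, the trivial zeros
and nothing else (there are no zeros on the real segment `[0, 1]`). It is the union of
`zetaZeroBox 0 T` and its conjugate (`weilZeroIndex_eq_union`) and is finite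
(`weilZeroIndex_finite`). (Bombieri 2000 Thm 2: zeros summed symmetrically in `|Im ρ| ≤ T`.) [cite: Bombieri2000, Thm 2: zeros summed symmetrically in  |I] -/
def weilZeroIndex (T : ℝ) : Set ℂ :=
  {ρ : ℂ | riemannZeta ρ = 0 ∧ 0 ≤ ρ.re ∧ ρ.re ≤ 1 ∧ ρ.im ≠ 0 ∧ |ρ.im| ≤ T}

/-- `weilZeroIndex T = zetaZeroBox 0 T ∪ conj (zetaZeroBox 0 T)` (conjugation symmetry
`riemannZeta_conj`; links the zero side to the counting boxes of `ZetaZeros`). [folklore] -/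
theorem weilZeroIndex_eq_union (T : ℝ) :
    weilZeroIndex T = zetaZeroBox 0 T ∪ (starRingEnd ℂ) '' zetaZeroBox 0 T := by
  ext ρ
  simp only [weilZeroIndex, zetaZeroBox, mem_setOf_eq, mem_union, mem_image]
  constructor
  · rintro ⟨h0, h1, h2, h3, h4⟩
    rcases lt_or_gt_of_ne h3 with h | h
    · refine Or.inr ⟨conj ρ, ⟨?_, ?_, ?_, ?_, ?_⟩, Complex.conj_conj ρ⟩
      · rw [riemannZeta_conj, h0, map_zero]
      · simpa using h1
      · simpa using h2
      · simpa using h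
      · rw [conj_im]; exact (neg_le_abs _).trans (by simpa [abs_neg] using h4)
    · exact Or.inl ⟨h0, h1, h2, h, (le_abs_self _).trans h4⟩
  · rintro (⟨h0, h1, h2, h3, h4⟩ | ⟨w, ⟨h0, h1, h2, h3, h4⟩, rfl⟩)
    · exact ⟨h0, h1, h2, h3.ne', by rwa [abs_of_pos h3]⟩
    · refine ⟨?_, ?_, ?_, ?_, ?_⟩
      · rw [riemannZeta_conj, h0, map_zero]
      · simpa using h1
      · simpa using h2
      · simpa using h3.ne'
      · simpa [abs_neg, abs_of_pos h3] using h4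

/-- The index set `weilZeroIndex T` is finite: it lies in the compact rectangle
`[0, 1] × [-T, T]`, and the zeros of `ζ` are discrete (`IsCompact.inter_riemannZetaZeros_finite`). [folklore] -/
theorem weilZeroIndex_finite (T : ℝ) : (weilZeroIndex T).Finite := by
  refine ((isCompact_Icc (a := (0 : ℝ)) (b := 1)).reProdIm
    (isCompact_Icc (a := -T) (b := T))).inter_riemannZetaZeros_finite.subset ?_
  rintro ρ ⟨h0, h1, h2, -, h4⟩
  exact ⟨Complex.mem_reProdIm.2 ⟨⟨h1, h2⟩, abs_le.1 h4⟩, h0⟩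

/-- The truncated zero side `∑_{|Im ρ| ≤ T} m(ρ) ĝ(ρ)`: a `finsum` over `weilZeroIndex T` (zeros of
`ζ` with `0 ≤ Re ρ ≤ 1` and `0 < |Im ρ| ≤ T`), weighted by the multiplicity
`riemannZetaZeroOrder ρ` (hypothesis-free; outline finding 4). The index set is finite
(`weilZeroSidePartial_support_finite`), so the `finsum` is a genuine finite sum.
(Bombieri 2000 Thm 2: zeros summed symmetrically with multiplicity.) [cite: Bombieri2000, Thm 2: zeros summed symmetrically with m] -/
def weilZeroSidePartial (g : ℝ → ℂ) (T : ℝ) : ℂ :=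
  ∑ᶠ ρ ∈ weilZeroIndex T, (riemannZetaZeroOrder ρ : ℂ) * weilMellin g ρ

/-- The (multiplicative) support of the summand of `weilZeroSidePartial g T` on its index set is
finite, so the `finsum` is not a junk value. [folklore] -/
theorem weilZeroSidePartial_support_finite (g : ℝ → ℂ) (T : ℝ) :
    (weilZeroIndex T ∩
      Function.support fun ρ ↦ (riemannZetaZeroOrder ρ : ℂ) * weilMellin g ρ).Finite :=
  (weilZeroIndex_finite T).subset inter_subset_left

/-- `HasWeilZeroSide g Z`: the symmetric sum over zeros converges to `Z`,
`∑_{|Im ρ| ≤ T} m(ρ) ĝ(ρ) → Z` as `T → ∞` (Bombieri 2000 Thm 2; IK Thm 5.12). [cite: Bombieri2000, Thm 2] -/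
def HasWeilZeroSide (g : ℝ → ℂ) (Z : ℂ) : Prop :=
  Tendsto (weilZeroSidePartial g) atTop (𝓝 Z)

/-! ## The quadratic functional and positivity -/

/-- Weil's quadratic (hermitian) functional `Q(g) := W(g ⋆ g̃)` (Weil 1952; Bombieri 2000 Thm 1;
Yoshida 1992). It is real (`weilQuadratic_im`). [cite: Weil1952] -/
def weilQuadratic (g : ℝ → ℂ) : ℂ :=
  weilFunctional (weilConv g (weilReflect g))

/-- OPEN CONJECTURE — Weil positivity for `ζ` [status: open]: `Re W(g ⋆ g̃) ≥ 0` for every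
smooth compactly supported `g : ℝ → ℂ` (Weil's quadratic functional `weilQuadratic` is positive
semidefinite on `IsWeilTest`). POSED by A. Weil (1952), who "formulated the Riemann Hypothesis as
the positivity of a certain quadratic functional arising from the Explicit Formula" (Bombieri 2000,
§1 p. 184, bib `Bombieri2000Weil`); in the present `ζ`-only, additive, `1/2`-symmetric
normalisation it is "`T[f * f̄*] ≥ 0` on `C₀^∞((0, ∞))`" of Bombieri 2000, Theorem 2 (p. 193), and
by that theorem (Weil's criterion) it is EQUIVALENT TO THE RIEMANN HYPOTHESIS — in the tree
unconditionally: `weil_criterion_holds : RiemannHypothesis ↔ WeilPositivity`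
(`WeilCriterionProofs.lean`; axioms `propext`, `Classical.choice`, `Quot.sound`). Hence a term
`WeilPositivity_holds` would prove Mathlib's `RiemannHypothesis`: this is a registered OPEN
statement (CONVENTIONS §4), not literature debt; users take `(h : WeilPositivity)`. Known
direction: `WeilPositivity.of_riemannHypothesis` (`WeilExplicitProofs.lean`). Name kept without a
`…Conjecture` suffix because it has users (`weil_criterion`, `WeilCriterion.lean`,
`UniformWeilPositivityRH.lean`, route theses `…/RiemannHypothesis/Theses/WeilPos.lean`, `SpectralTrace.lean`).
[cite: Weil1952FormulesExplicites, pp. 252–265 (RH formulated as positivity of the explicit-formula functional); ζ-form Bombieri2000Weil Thm. 2 p. 193] -/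
@[conjecture] def WeilPositivity : Prop :=
  ∀ g : ℝ → ℂ, IsWeilTest g → 0 ≤ (weilQuadratic g).re

/-- Weil positivity on the truncated cone `K_a`: `W(g ⋆ g̃) ≥ 0` for every smooth `g` supported in
`[-a, a]` (i.e. `supp φ ⊆ [e^{-a}, e^{a}]` multiplicatively; Bombieri 2000 §§3–4, Yoshida 1992).
This `∀`-form is the junk-free shape used by target statements (rh.S29 wall); compare
`weilGroundEnergy`. For `a < 0` it holds trivially (`tsupport g = ∅` forces `g = 0` and
`Q(0) = 0`). [cite: Bombieri2000, §§3–4  Yoshida 1992] -/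
def WeilPositivityOn (a : ℝ) : Prop :=
  ∀ g : ℝ → ℂ, IsWeilTest g → tsupport g ⊆ Icc (-a) a → 0 ≤ (weilQuadratic g).re

/-- The ground energy `ε(a) := inf {Q(g) : g smooth, supp g ⊆ [-a, a], ‖g‖₂ = 1}`
(Bombieri 2000 §4; Yoshida 1992). DEFINITION ONLY: this is a real `sInf` (junk value `0` if the
set were empty or unbounded below; it is bounded below, `bddBelow_weilQuadratic_sphere`); target
statements use the junk-free `WeilPositivityOn` (see `weilGroundEnergy_nonneg_iff`). [cite: Bombieri2000, §4] -/
def weilGroundEnergy (a : ℝ) : ℝ :=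
  sInf {x : ℝ | ∃ g : ℝ → ℂ, IsWeilTest g ∧ tsupport g ⊆ Icc (-a) a ∧
    ∫ t : ℝ, ‖g t‖ ^ 2 = 1 ∧ x = (weilQuadratic g).re}

/-! ## API -/

section API

variable {g h : ℝ → ℂ}

/-- Transform of the involution: `(g̃)^(s) = conj (ĝ(1 - conj s))` (substitute `t ↦ -t`;
Bombieri 2000 §2, `f̃*(s) = f̃(1 - s)` for real `f`). No hypotheses: both sides are `0` when the
integrals diverge. [cite: Bombieri2000, §2   f̃ (s] -/
def weilMellin_weilReflect : Prop :=
  ∀ (g : ℝ → ℂ) (s : ℂ),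
    weilMellin (weilReflect g) s = conj (weilMellin g (1 - conj s))

/-- Multiplicativity: `(g ⋆ h)^(s) = ĝ(s) ĥ(s)` for continuous compactly supported `g, h`
(Fubini; Bombieri 2000 §2). In particular it holds for test functions. [cite: Bombieri2000, §2] -/
def weilMellin_weilConv : Prop :=
  ∀ {g h : ℝ → ℂ}, Continuous g → HasCompactSupport g → Continuous h → HasCompactSupport h →
    ∀ s : ℂ, weilMellin (weilConv g h) s = weilMellin g s * weilMellin h s

/-- The convolution of two test functions is a test function
(`HasCompactSupport.convolution`, `HasCompactSupport.contDiff_convolution_right`). [folklore] -/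
theorem IsWeilTest.weilConv (hg : IsWeilTest g) (hh : IsWeilTest h) :
    IsWeilTest (Literature.NumberTheory.LFunctions.weilConv g h) := by
  rw [weilConv_eq_convolution_real]
  exact ⟨hh.2.contDiff_convolution_right (ContinuousLinearMap.mul ℝ ℂ)
      hg.1.continuous.locallyIntegrable hh.1,
    HasCompactSupport.convolution (L := ContinuousLinearMap.mul ℝ ℂ) hg.2 hh.2⟩

/-- The involution preserves test functions. [folklore] -/
theorem IsWeilTest.weilReflect (hg : IsWeilTest g) : IsWeilTest (weilReflect g) :=
  ⟨ContDiff.comp Complex.conjCLE.contDiff (ContDiff.comp hg.1 contDiff_neg),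
    (hg.2.comp_homeomorph (Homeomorph.neg ℝ)).comp_left (g := conj) (map_zero _)⟩

/-- The quadratic functional is real: `Im W(g ⋆ g̃) = 0`, since `k = g ⋆ g̃` satisfies `k̃ = k`,
whence `k̂(0) = conj k̂(1)`, `k(-t) = conj k(t)` and each of the three terms of `W(k)` is real
(Bombieri 2000 §2; Yoshida 1992). [cite: Bombieri2000, §2] -/
def weilQuadratic_im : Prop :=
  ∀ {g : ℝ → ℂ}, IsWeilTest g → (weilQuadratic g).im = 0

/-- For compactly supported `g` the prime sum has finite support (only `log n ≤ sup |supp g|`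
contribute), hence is summable. [folklore] -/
theorem summable_weilPrimeTerm (hg : HasCompactSupport g) :
    Summable fun n : ℕ ↦
      ((Λ n : ℝ) : ℂ) / (Real.sqrt n : ℂ) * (g (Real.log n) + g (-Real.log n)) := by
  obtain ⟨R, hR⟩ := hg.isCompact.isBounded.subset_closedBall 0
  refine summable_of_ne_finset_zero (s := Finset.range ⌈Real.exp (|R| + 1)⌉₊) fun n hn ↦ ?_
  rw [Finset.mem_range, not_lt] at hn
  have hn' : Real.exp (|R| + 1) ≤ n := (Nat.le_ceil _).trans (by exact_mod_cast hn)
  have hpos : (0 : ℝ) < n := (Real.exp_pos _).trans_le hn'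
  have hlog : |R| + 1 ≤ Real.log n := by rwa [Real.le_log_iff_exp_le hpos]
  have h0 : ∀ x : ℝ, |R| < |x| → g x = 0 := fun x hx ↦
    image_eq_zero_of_notMem_tsupport fun hxs ↦ by
      have hxR := hR hxs
      rw [Metric.mem_closedBall, dist_zero_right, Real.norm_eq_abs] at hxR
      linarith [le_abs_self R]
  have h1 : |R| < |Real.log n| :=
    lt_of_lt_of_le (by linarith) (le_abs_self _)
  rw [h0 _ h1, h0 _ (by rwa [abs_neg]), add_zero, mul_zero]

/-- Bombieri's archimedean term equals the digamma form (Bombieri 2000 Thm 2 vs.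
Iwaniec–Kowalski (5.44); Gauss' integral for `ψ` and Fourier inversion — see the module
docstring). [cite: Bombieri2000, Thm 2 vs. Iwaniec–Kowalski (5.44] -/
def weilArchTermBombieri_eq_weilArchTerm : Prop :=
  ∀ {g : ℝ → ℂ}, IsWeilTest g → weilArchTermBombieri g = weilArchTerm g

/-- The Guinand–Weil explicit formula for `ζ`: for a smooth compactly supported `g`,
`lim_{T → ∞} ∑_{|Im ρ| ≤ T} m(ρ) ĝ(ρ) = ĝ(0) + ĝ(1) - ∑ₙ Λ(n) n^{-1/2}(g(log n) + g(-log n)) + W_∞(g)`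
(Weil 1952; Bombieri 2000 Thm 2; Iwaniec–Kowalski Thm 5.12). Restated with its inventory id in
`Statements/RH/WeilCriterion`. [cite: Weil1952] -/
def explicit_formula : Prop :=
  ∀ {g : ℝ → ℂ}, IsWeilTest g → HasWeilZeroSide g (weilFunctional g)

/-- The values `Q(g)` on the unit `L²`-sphere of test functions supported in `[-a, a]` are
bounded below (each term of `W(g ⋆ g̃)` is bounded by a constant depending only on `a` times
`‖g‖₂²`; Bombieri 2000 §4). [cite: Bombieri2000, §4] -/
def bddBelow_weilQuadratic_sphere : Prop :=
  ∀ (a : ℝ),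
    BddBelow {x : ℝ | ∃ g : ℝ → ℂ, IsWeilTest g ∧ tsupport g ⊆ Icc (-a) a ∧
      ∫ t : ℝ, ‖g t‖ ^ 2 = 1 ∧ x = (weilQuadratic g).re}

/-- For `a > 0`, `ε(a) ≥ 0` iff Weil positivity holds on `[-a, a]` (homogeneity
`Q(c • g) = |c|² Q(g)`, `bddBelow_weilQuadratic_sphere`, and non-emptiness of the sphere for
`a > 0`; Bombieri 2000 §4, Yoshida 1992). [cite: Bombieri2000, §4  Yoshida 1992] -/
def weilGroundEnergy_nonneg_iff : Prop :=
  ∀ {a : ℝ}, 0 < a → (0 ≤ weilGroundEnergy a ↔ WeilPositivityOn a)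

end API

end Literature.NumberTheory.LFunctions
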